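import Mathlib

/-!
# Hermite data of a rational function

Stub `stub_hermiteData` of the crux `InverseLandauRationalCurves` (line `Sketch`): over a field
`L` of characteristic zero, a rational function `F` whose reduced (monic) denominator `D` splits
is the derivative of some `M/Dⁿ` plus a simple-pole part supported on the roots of `D`:
`F = (M′·D - n·M·D′)/D^{n+1} + Σ_p a_p/(X - p)`.

Proof: full partial-fraction decomposition
(`Polynomial.mul_prod_pow_inverse_eq_quo_add_sum_rem_mul_pow_inverse`)
`F = q + Σ_p Σ_{j < m_p} c_{p,j}/(X - p)^{j+1}`; the polynomial part and the pole orders `≥ 2`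
are exact in characteristic zero (`q = (∫q)′`, `(X - p)^{-(k+2)} = (-(k+1)⁻¹ (X - p)^{-(k+1)})′`,
and `(X - p)^{k+1} ∣ D`), the order-one parts are the residues. We always take `n = 1`. The set
of rational functions admitting such a "Hermite representation" with respect to a fixed `D` is
closed under sums and scalars, which is how the pieces are assembled.
-/

noncomputable section

open Polynomial

namespace Summit.KontsevichZagierPeriods.InverseLandau.RationalCurves

variable {L : Type*} [Field L] [CharZero L] [DecidableEq L]

omit [DecidableEq L] in
/-- Every polynomial over a field of characteristic zero has a polynomial primitive. -/
theorem hermite_exists_derivative_eq (Q : L[X]) : ∃ P : L[X], derivative P = Q := by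
  induction Q using Polynomial.induction_on' with
  | add p q hp hq =>
      obtain ⟨P, hP⟩ := hp
      obtain ⟨R, hR⟩ := hq
      exact ⟨P + R, by rw [derivative_add, hP, hR]⟩
  | monomial n a =>
      refine ⟨monomial (n + 1) (a / (n + 1)), ?_⟩
      rw [derivative_monomial]
      have hn : ((n : L) + 1) ≠ 0 := by exact_mod_cast Nat.succ_ne_zero n
      simp only [Nat.add_sub_cancel, Nat.cast_add, Nat.cast_one]
      congr 1
      field_simp

omit [CharZero L] in
/-- A root of `D` (listed in `D.roots.toFinset`) lies in the root set `D.rootSet L`. -/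
theorem hermite_mem_rootSet_of_mem {D : L[X]} {p : L} (hp : p ∈ D.roots.toFinset) :
    p ∈ D.rootSet L := by
  rw [Multiset.mem_toFinset, mem_roots'] at hp
  exact Polynomial.mem_rootSet.mpr ⟨hp.1, hp.2⟩

omit [CharZero L] [DecidableEq L] in
/-- `RatFunc.X - RatFunc.C p` is the image of the polynomial `X - C p`. -/
theorem hermite_X_sub_C (p : L) :
    (RatFunc.X - RatFunc.C p : RatFunc L) = algebraMap L[X] (RatFunc L) (X - C p) := by
  rw [map_sub, RatFunc.algebraMap_X, RatFunc.algebraMap_C]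

omit [CharZero L] in
/-- Hermite representations (w.r.t. a fixed `D`): `0` has one. -/
theorem hermiteRep_zero (D : L[X]) :
    ∃ (M : L[X]) (a : L → L), (∀ x, x ∉ D.rootSet L → a x = 0) ∧
      (0 : RatFunc L) =
          algebraMap L[X] (RatFunc L) (derivative M * D - M * derivative D) /
            algebraMap L[X] (RatFunc L) (D ^ 2) +
          ∑ p ∈ D.roots.toFinset, RatFunc.C (a p) * (RatFunc.X - RatFunc.C p)⁻¹ :=
  ⟨0, 0, fun _ _ => rfl, by simp⟩

/-- Hermite representations are closed under addition. -/
theorem hermiteRep_add {D : L[X]} {f g : RatFunc L}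
    (hf : ∃ (M : L[X]) (a : L → L), (∀ x, x ∉ D.rootSet L → a x = 0) ∧
      f = algebraMap L[X] (RatFunc L) (derivative M * D - M * derivative D) /
            algebraMap L[X] (RatFunc L) (D ^ 2) +
          ∑ p ∈ D.roots.toFinset, RatFunc.C (a p) * (RatFunc.X - RatFunc.C p)⁻¹)
    (hg : ∃ (M : L[X]) (a : L → L), (∀ x, x ∉ D.rootSet L → a x = 0) ∧
      g = algebraMap L[X] (RatFunc L) (derivative M * D - M * derivative D) /
            algebraMap L[X] (RatFunc L) (D ^ 2) +
          ∑ p ∈ D.roots.toFinset, RatFunc.C (a p) * (RatFunc.X - RatFunc.C p)⁻¹) :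
    ∃ (M : L[X]) (a : L → L), (∀ x, x ∉ D.rootSet L → a x = 0) ∧
      f + g = algebraMap L[X] (RatFunc L) (derivative M * D - M * derivative D) /
            algebraMap L[X] (RatFunc L) (D ^ 2) +
          ∑ p ∈ D.roots.toFinset, RatFunc.C (a p) * (RatFunc.X - RatFunc.C p)⁻¹ := by
  obtain ⟨M₁, a₁, ha₁, rfl⟩ := hf
  obtain ⟨M₂, a₂, ha₂, rfl⟩ := hg
  refine ⟨M₁ + M₂, a₁ + a₂, fun x hx => by simp [ha₁ x hx, ha₂ x hx], ?_⟩
  have h1 : algebraMap L[X] (RatFunc L) (derivative (M₁ + M₂) * D - (M₁ + M₂) * derivative D) =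
      algebraMap L[X] (RatFunc L) (derivative M₁ * D - M₁ * derivative D) +
        algebraMap L[X] (RatFunc L) (derivative M₂ * D - M₂ * derivative D) := by
    rw [← map_add, derivative_add]
    exact congrArg _ (by ring)
  rw [h1, add_div]
  simp only [Pi.add_apply, map_add, add_mul, Finset.sum_add_distrib]
  abel

omit [CharZero L] in
/-- Hermite representations are closed under multiplication by constants. -/
theorem hermiteRep_smul {D : L[X]} {f : RatFunc L} (c : L)
    (hf : ∃ (M : L[X]) (a : L → L), (∀ x, x ∉ D.rootSet L → a x = 0) ∧
      f = algebraMap L[X] (RatFunc L) (derivative M * D - M * derivative D) /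
            algebraMap L[X] (RatFunc L) (D ^ 2) +
          ∑ p ∈ D.roots.toFinset, RatFunc.C (a p) * (RatFunc.X - RatFunc.C p)⁻¹) :
    ∃ (M : L[X]) (a : L → L), (∀ x, x ∉ D.rootSet L → a x = 0) ∧
      RatFunc.C c * f = algebraMap L[X] (RatFunc L) (derivative M * D - M * derivative D) /
            algebraMap L[X] (RatFunc L) (D ^ 2) +
          ∑ p ∈ D.roots.toFinset, RatFunc.C (a p) * (RatFunc.X - RatFunc.C p)⁻¹ := by
  obtain ⟨M, a, ha, rfl⟩ := hf
  refine ⟨C c * M, fun x => c * a x, fun x hx => by simp [ha x hx], ?_⟩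
  rw [mul_add, Finset.mul_sum]
  congr 1
  · rw [mul_div_assoc', ← RatFunc.algebraMap_C, ← map_mul]
    refine congrArg (· / _) (congrArg _ ?_)
    rw [derivative_C_mul]
    ring
  · refine Finset.sum_congr rfl fun x _ => ?_
    rw [map_mul, mul_assoc]

/-- A finite sum of functions with Hermite representations has one. -/
theorem hermiteRep_sum {D : L[X]} {ι : Type*} (s : Finset ι) (f : ι → RatFunc L)
    (h : ∀ i ∈ s, ∃ (M : L[X]) (a : L → L), (∀ x, x ∉ D.rootSet L → a x = 0) ∧
      f i = algebraMap L[X] (RatFunc L) (derivative M * D - M * derivative D) /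
            algebraMap L[X] (RatFunc L) (D ^ 2) +
          ∑ p ∈ D.roots.toFinset, RatFunc.C (a p) * (RatFunc.X - RatFunc.C p)⁻¹) :
    ∃ (M : L[X]) (a : L → L), (∀ x, x ∉ D.rootSet L → a x = 0) ∧
      ∑ i ∈ s, f i = algebraMap L[X] (RatFunc L) (derivative M * D - M * derivative D) /
            algebraMap L[X] (RatFunc L) (D ^ 2) +
          ∑ p ∈ D.roots.toFinset, RatFunc.C (a p) * (RatFunc.X - RatFunc.C p)⁻¹ :=
  Finset.sum_induction f
    (fun g => ∃ (M : L[X]) (a : L → L), (∀ x, x ∉ D.rootSet L → a x = 0) ∧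
      g = algebraMap L[X] (RatFunc L) (derivative M * D - M * derivative D) /
            algebraMap L[X] (RatFunc L) (D ^ 2) +
          ∑ p ∈ D.roots.toFinset, RatFunc.C (a p) * (RatFunc.X - RatFunc.C p)⁻¹)
    (fun _ _ => hermiteRep_add) (hermiteRep_zero D) h

/-- Polynomials are exact: `q = ((D·∫q)/D)′`. -/
theorem hermiteRep_polynomial {D : L[X]} (hD : D ≠ 0) (q : L[X]) :
    ∃ (M : L[X]) (a : L → L), (∀ x, x ∉ D.rootSet L → a x = 0) ∧
      algebraMap L[X] (RatFunc L) q =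
          algebraMap L[X] (RatFunc L) (derivative M * D - M * derivative D) /
            algebraMap L[X] (RatFunc L) (D ^ 2) +
          ∑ p ∈ D.roots.toFinset, RatFunc.C (a p) * (RatFunc.X - RatFunc.C p)⁻¹ := by
  obtain ⟨P, hP⟩ := hermite_exists_derivative_eq q
  refine ⟨D * P, 0, fun _ _ => rfl, ?_⟩
  simp only [Pi.zero_apply, map_zero, zero_mul, Finset.sum_const_zero, add_zero]
  rw [eq_div_iff (RatFunc.algebraMap_ne_zero (pow_ne_zero 2 hD)), ← map_mul]
  refine congrArg _ ?_
  rw [derivative_mul, hP]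
  ring

omit [CharZero L] in
/-- The simple pole `1/(X - p)` at a root `p` of `D` is its own residue part. -/
theorem hermiteRep_inv_X_sub_C {D : L[X]} {p : L} (hp : p ∈ D.roots.toFinset) :
    ∃ (M : L[X]) (a : L → L), (∀ x, x ∉ D.rootSet L → a x = 0) ∧
      (RatFunc.X - RatFunc.C p : RatFunc L)⁻¹ =
          algebraMap L[X] (RatFunc L) (derivative M * D - M * derivative D) /
            algebraMap L[X] (RatFunc L) (D ^ 2) +
          ∑ x ∈ D.roots.toFinset, RatFunc.C (a x) * (RatFunc.X - RatFunc.C x)⁻¹ := by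
  refine ⟨0, fun x => if x = p then 1 else 0, fun x hx => ?_, ?_⟩
  · exact if_neg fun h => hx (by rw [h]; exact hermite_mem_rootSet_of_mem hp)
  · simp only [zero_mul, sub_self, map_zero, zero_div, zero_add]
    simp [apply_ite RatFunc.C, ite_mul, hp]

/-- Poles of order `k + 2 ≥ 2` at a root `p` of multiplicity `≥ k + 2` of `D` are exact:
`(X - p)^{-(k+2)} = (-(k+1)⁻¹ · G/D)′` where `D = (X - p)^{k+1} · G`. -/
theorem hermiteRep_inv_X_sub_C_pow_add_two {D : L[X]} (hD : D ≠ 0) {p : L} (k : ℕ)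
    (hk : k + 2 ≤ D.roots.count p) :
    ∃ (M : L[X]) (a : L → L), (∀ x, x ∉ D.rootSet L → a x = 0) ∧
      (RatFunc.X - RatFunc.C p : RatFunc L)⁻¹ ^ (k + 2) =
          algebraMap L[X] (RatFunc L) (derivative M * D - M * derivative D) /
            algebraMap L[X] (RatFunc L) (D ^ 2) +
          ∑ x ∈ D.roots.toFinset, RatFunc.C (a x) * (RatFunc.X - RatFunc.C x)⁻¹ := by
  obtain ⟨G, hG⟩ : (X - C p) ^ (k + 1) ∣ D := by
    rw [count_roots] at hk
    exact (pow_dvd_pow _ (by omega)).trans (pow_rootMultiplicity_dvd D p)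
  have hk1 : ((k : L) + 1) ≠ 0 := by exact_mod_cast Nat.succ_ne_zero k
  have hc : C (-((k : L) + 1)⁻¹) * C ((k : L) + 1) = -1 := by
    rw [← C_mul, neg_mul, inv_mul_cancel₀ hk1, C_neg, C_1]
  refine ⟨C (-((k : L) + 1)⁻¹) * G, 0, fun _ _ => rfl, ?_⟩
  simp only [Pi.zero_apply, map_zero, zero_mul, Finset.sum_const_zero, add_zero]
  have hne : algebraMap L[X] (RatFunc L) ((X - C p) ^ (k + 2)) ≠ 0 :=
    RatFunc.algebraMap_ne_zero (pow_ne_zero _ (X_sub_C_ne_zero p))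
  rw [hermite_X_sub_C, inv_pow, ← map_pow,
    eq_div_iff (RatFunc.algebraMap_ne_zero (pow_ne_zero 2 hD)),
    inv_mul_eq_iff_eq_mul₀ hne, ← map_mul]
  refine congrArg _ ?_
  subst hG
  simp only [derivative_mul, derivative_pow_succ, derivative_X_sub_C,
    derivative_C, zero_mul, zero_add, mul_one]
  linear_combination ((X - C p) ^ (k + 1) * G) ^ 2 * hc

/-- All poles `1/(X - p)^{j+1}` with `j + 1 ≤ m_p` (the multiplicity of the root `p` of `D`)
have a Hermite representation. -/
theorem hermiteRep_inv_X_sub_C_pow {D : L[X]} (hD : D ≠ 0) {p : L} (j : ℕ)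
    (hj : j + 1 ≤ D.roots.count p) :
    ∃ (M : L[X]) (a : L → L), (∀ x, x ∉ D.rootSet L → a x = 0) ∧
      (RatFunc.X - RatFunc.C p : RatFunc L)⁻¹ ^ (j + 1) =
          algebraMap L[X] (RatFunc L) (derivative M * D - M * derivative D) /
            algebraMap L[X] (RatFunc L) (D ^ 2) +
          ∑ x ∈ D.roots.toFinset, RatFunc.C (a x) * (RatFunc.X - RatFunc.C x)⁻¹ := by
  rcases j with _ | k
  · have hp : p ∈ D.roots.toFinset :=
      Multiset.mem_toFinset.mpr (Multiset.count_pos.mp (by omega))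
    rw [zero_add, pow_one]
    exact hermiteRep_inv_X_sub_C hp
  · exact hermiteRep_inv_X_sub_C_pow_add_two hD k hj

/-- **Hermite data.** Over a field `L` of characteristic zero, a rational function whose reduced
denominator `D` splits is the derivative of some `M/Dⁿ` plus a simple-pole part supported on the
roots of `D`: `F = (M′·D - n·M·D′)/D^{n+1} + Σ_p a_p/(X - p)` (partial fractions; pole orders
`≥ 2` are exact in characteristic zero). -/
theorem stub_hermiteData {L : Type*} [Field L] [CharZero L] [DecidableEq L] (F : RatFunc L)
    (hF : F.denom.Splits) :
    ∃ (M : L[X]) (n : ℕ) (a : L → L), (∀ x, x ∉ F.denom.rootSet L → a x = 0) ∧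
      F = algebraMap L[X] (RatFunc L) (derivative M * F.denom - n • (M * derivative F.denom)) /
            algebraMap L[X] (RatFunc L) (F.denom ^ (n + 1)) +
          ∑ p ∈ F.denom.roots.toFinset, RatFunc.C (a p) * (RatFunc.X - RatFunc.C p)⁻¹ := by
  set D := F.denom with hD_def
  have hD : D ≠ 0 := RatFunc.denom_ne_zero F
  have hmonic : D.Monic := RatFunc.monic_denom F
  have hprod : D = ∏ p ∈ D.roots.toFinset, (X - C p) ^ D.roots.count p := by
    conv_lhs => rw [hF.eq_prod_roots_of_monic hmonic]
    rw [Finset.prod_multiset_map_count]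
  have hgi : ∀ i ∈ D.roots.toFinset,
      (RatFunc.X - RatFunc.C i : RatFunc L)⁻¹ * algebraMap L[X] (RatFunc L) (X - C i) = 1 :=
    fun i _ => by
      rw [hermite_X_sub_C]
      exact inv_mul_cancel₀ (RatFunc.algebraMap_ne_zero (X_sub_C_ne_zero i))
  have hcop : Set.Pairwise (↑D.roots.toFinset : Set L) fun i j => IsCoprime (X - C i) (X - C j) :=
    fun i _ j _ hij => isCoprime_X_sub_C_of_isUnit_sub (sub_ne_zero_of_ne hij).isUnit
  obtain ⟨q, r, hr, hf⟩ := mul_prod_pow_inverse_eq_quo_add_sum_rem_mul_pow_inverse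
    (K := RatFunc L) F.num (fun i _ => monic_X_sub_C i) hcop (fun i => D.roots.count i) hgi
  have hF_eq : F = algebraMap L[X] (RatFunc L) F.num *
      ∏ i ∈ D.roots.toFinset, (RatFunc.X - RatFunc.C i : RatFunc L)⁻¹ ^ D.roots.count i := by
    have hinv : (algebraMap L[X] (RatFunc L) D)⁻¹ =
        ∏ i ∈ D.roots.toFinset, (RatFunc.X - RatFunc.C i : RatFunc L)⁻¹ ^ D.roots.count i :=
      calc (algebraMap L[X] (RatFunc L) D)⁻¹
          = (algebraMap L[X] (RatFunc L)
              (∏ p ∈ D.roots.toFinset, (X - C p) ^ D.roots.count p))⁻¹ := by rw [← hprod]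
        _ = ∏ i ∈ D.roots.toFinset, (RatFunc.X - RatFunc.C i : RatFunc L)⁻¹ ^ D.roots.count i := by
            rw [map_prod, ← Finset.prod_inv_distrib]
            refine Finset.prod_congr rfl fun i _ => ?_
            rw [map_pow, ← inv_pow, hermite_X_sub_C]
    conv_lhs => rw [← RatFunc.num_div_denom F]
    rw [div_eq_mul_inv, hinv]
  have hRep : ∃ (M : L[X]) (a : L → L), (∀ x, x ∉ D.rootSet L → a x = 0) ∧
      F = algebraMap L[X] (RatFunc L) (derivative M * D - M * derivative D) /
            algebraMap L[X] (RatFunc L) (D ^ 2) +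
          ∑ p ∈ D.roots.toFinset, RatFunc.C (a p) * (RatFunc.X - RatFunc.C p)⁻¹ := by
    rw [hF_eq, hf]
    refine hermiteRep_add (hermiteRep_polynomial hD q) (hermiteRep_sum _ _ fun i hi => ?_)
    refine hermiteRep_sum _ _ fun j _ => ?_
    have hdeg : (r i j).degree ≤ 0 := by
      have := hr i hi j
      rw [degree_X_sub_C] at this
      exact Nat.WithBot.lt_one_iff_le_zero.mp this
    rw [eq_C_of_degree_le_zero hdeg, RatFunc.algebraMap_C]
    exact hermiteRep_smul _ (hermiteRep_inv_X_sub_C_pow hD j.1 j.2)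
  obtain ⟨M, a, ha, hrep⟩ := hRep
  refine ⟨M, 1, a, ha, ?_⟩
  rw [one_smul, one_add_one_eq_two]
  exact hrep

end Summit.KontsevichZagierPeriods.InverseLandau.RationalCurves

end
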